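import Summits.HubbardSuperconductivity.HubbardSuperconductivity.Theses.KacWindowPenalty
import Summits.HubbardSuperconductivity.HubbardSuperconductivity.Theorems.NoGoNogoSingletPairKillsSaturatedFM
import Literature.MathematicalPhysics.QuantumLattice.PairFieldMomentum
import Literature.MathematicalPhysics.QuantumLattice.ApproximateEigenvectorLemmas
import Literature.MathematicalPhysics.QuantumLattice.DWaveSourceProofs

/-!
# Disproof of `WindowInfraredBound` — findings (cdisprove cycle 1, 2026-08-16)

Crux (item `stmt-HubbardSuperconductivity-1089`; route FunctionFieldCertificate rank 4, route KacWindowPenalty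
rank 3 — the two route copies are the SAME term, `Iff.rfl`, see §0):

  `∀ U > 0, ∀ δ ∈ (0, 1/2), ∃ C ≥ 0, ε₀ > 0, L₀, ∀ ε ∈ (0, ε₀], ∀ even L ≥ L₀, ∀ ψ, ‖ψ‖ = 1 →`
  `  IsGroundStateInSector (hubbardTorus 2 L 1 U) (2⌊(1-δ)L²/2⌋) 0 ψ →`
  `  T_ε(ψ) := Σ_{m ≠ 0, |q_m|² ≤ ε²} S_ψ(m) ≤ C ε L²`,   `S_ψ(m) = ‖Δ_d(m) ψ‖² / L²`.

READ-BACK (probe `W.lean`, rc 0): the route's inlined `let D := …`, its summand and its window condition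
are DEFINITIONALLY the tree's `pairFieldAt dWaveFormFactor L`, `pairStructureFactor dWaveFormFactor L ψ m`
and `momentumNormSq L m ≤ ε²` (`crux_iff_structureFactor`, `Iff.rfl`).  No junk operators (`NeZero L`
everywhere, no ℕ-subtraction, `.val` of the `ZMod L` dot product is well defined mod `L`), sector non-empty,
ground states exist: NOT vacuous.  `IsGroundStateInSector` is a cone (normalisation is a separate
hypothesis); `C, ε₀, L₀` depend on `(U, δ)` only; `L₀` does not depend on `ε`, so the binding pairs are
`ε L ≥ 2π` (`windowSum_eq_zero_of_sq_lt`: otherwise the window is empty).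

VERDICT AFTER CYCLE 1: **no kill, and none is reachable with present means** — every variant of the
statement (including every hypothesis mutation below) quantifies `∃ L₀ ∀ L ≥ L₀` over EXACT sector ground
states of the doped two-dimensional Hubbard model, which no rigorous method controls at any
`(U, δ) ∈ (0, ∞) × (0, 1/2)`; no finite computation bites an `∃ ε₀ ∃ L₀` statement.  What a refutation must
look like: a point `(U, δ)` and, for every `C`, ground states `ψ_L` on arbitrarily large even tori with
`S_{ψ_L}(q_min) > 2π C L` (`Θ(L)` `d`-wave pairs condensed at the smallest nonzero momentum) or, at fixed
`ε`, `T_ε(ψ_L) ≥ c L²` with `c` not `O(ε)` — physically: phase separation with a superconducting component,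
or a pair-density wave with `|Q| → 0`.  Everything below is kernel-checked (no `sorry` outside §5); prose
only in docstrings.

## Index

* §0 `crux_iff_structureFactor` — normal form (`Iff.rfl`); the two route copies coincide (`Iff.rfl`, probe).
* §1 PARSEVAL CEILING (LANDED: `Theorems/WindowInfraredBound/Negative/ParsevalCeiling.lean`, p90310):
  `windowSum_le_localPairSum`, `localPair_dWave_mulVec_normSq_le` (`‖P_xψ‖² ≤ 32‖ψ‖²`),
  `windowSum_le_thirtyTwo_mul_sq` (`T_ε ≤ 32 L²` for EVERY normalised vector), `windowSum_le_of_thirtyTwo_le`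
  (the crux is AUTOMATIC once `32 ≤ Cε`: content = the factor `Cε/32` as `ε → 0`; NOT trivial, NOT vacuous),
  `windowSum_eq_zero_of_sq_lt` (empty window), `windowInfraredBound_allEps` (`ε₀` is cosmetic).
* §2 LOAD-BEARING HYPOTHESES (LANDED: `…/Negative/LoadBearing.lean`, p90512):
  `pairField_mulVec_eq_zero_of_withZeroMode` — admit `m = 0` ⇒ `Δ_d ψ = 0` on every GS, every large even
  `L`, every `(U,δ)`;  `pairFieldAt_mulVec_eq_zero_of_withoutNormalisation` — drop `‖ψ‖ = 1` ⇒ `Δ_d(m)ψ = 0`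
  for all window `m`.  (Both mutated statements collapse to exact vanishing laws; neither is refuted, for
  the reason above.)  Dropping `ε ≤ ε₀`: nothing changes (§1).  `0 < U`, `δ < 1/2`, `Even L`: no provable
  role (see §4: `U = 0` obeys the bound numerically; `δ → 0` is the Mott/AFM side).
* §3 SATURATED FERROMAGNETS (LANDED: `…/Negative/SaturatedFerromagnet.lean`, p90686):
  `windowSum_eq_zero_of_saturated` — `T_ε ≡ 0` along maximal-spin states (tree: NoGo crux 5), so the
  Nagaoka corner (large `U`, small `δ`) can never host a counterexample.
* (evidence on the item, not landed: `Reduction.lean` — `PointwiseGoldstoneShape → WindowInfraredBound` with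
  `C = 32K` via the tree's `wls_window_sum_le`; a pointwise `S_ψ(m)|q_m| ≤ K` bound is all a prover needs.)
* §4 `attacksOnPaper` — the attack log: `U = 0` Wick calibration (kit job `j015079`), physics kill
  candidates with references, degenerate-multiplet superpositions, why it resists.
* §5 NEAR-MISS (the only `sorry`): `not_windowBoundAllSectorStates` — the GROUND-STATE hypothesis is
  load-bearing: the bound fails for general normalised sector states (explicit witness: doublon block ×
  dilute SLOT CONDENSATE of `Θ(L)` horizontal bond singlets at momentum `q₁`, with the EXACT Dicke identity
  `‖B_{q₁}ψ_n‖²/‖ψ_n‖² = n(M-n+1)`; proof on paper, formalisation = occupation-basis bookkeeping on the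
  Jordan–Wigner Fock space, not attempted this cycle).
-/

set_option linter.dupNamespace false

noncomputable section

namespace Summit.HubbardSuperconductivity.HubbardSuperconductivity.Cruxes.WindowInfraredBound.Disproof

open Literature.MathematicalPhysics.QuantumLattice Literature.Probability.LatticeModels Matrix Finset
open Summit.HubbardSuperconductivity.HubbardSuperconductivity.Theses.KacWindowPenalty
open scoped Matrix.Norms.L2Operator ComplexOrder

/-! ## §0 The crux and its normal forms -/

/- The two route copies (FunctionFieldCertificate rank 4, KacWindowPenalty rank 3) are ONE term:
`theorem crux_iff_kac : Theses.FunctionFieldCertificate.WindowInfraredBound ↔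
Theses.KacWindowPenalty.WindowInfraredBound := Iff.rfl` — checked in the probe `W.lean` (rc 0,
2026-08-16T07:00Z).  It is not restated here because this work file imports the KacWindowPenalty route file
only (the FunctionFieldCertificate route file was being re-gated, rev 4, while this was written); every
statement below is about `Theses.KacWindowPenalty.WindowInfraredBound`, i.e. about the shared item. -/

variable (L : ℕ) [NeZero L]

/-! ## §1 Parseval ceiling: non-triviality threshold, empty window, `ε₀` cosmetic -/

/-- The window tail of the crux, `T_ε(ψ) = Σ_{m ≠ 0, |q_m|² ≤ ε²} S_ψ(m)` with the tree's
`pairStructureFactor` / `momentumNormSq` (definitionally the route's summand and window condition). [folklore] -/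
theorem crux_iff_structureFactor :
    WindowInfraredBound ↔ ∀ U : ℝ, 0 < U → ∀ δ ∈ Set.Ioo (0:ℝ) (1 / 2), ∃ C ε₀ : ℝ, 0 ≤ C ∧ 0 < ε₀ ∧ ∃ L₀ : ℕ,
      ∀ ε ∈ Set.Ioc (0:ℝ) ε₀, ∀ (L : ℕ) [NeZero L], L₀ ≤ L → Even L →
        ∀ ψ : Fock (Orb (FermionTorus 2 L)), star ψ ⬝ᵥ ψ = 1 →
          IsGroundStateInSector (hubbardTorus 2 L 1 U) (2 * ⌊(1 - δ) * (L : ℝ) ^ 2 / 2⌋₊) 0 ψ →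
            (∑ m : TorusSite 2 L, if m ≠ 0 ∧ momentumNormSq L m ≤ ε ^ 2 then
                pairStructureFactor dWaveFormFactor L ψ m else 0) ≤ C * ε * (L : ℝ) ^ 2 :=
  Iff.rfl


/-- **Parseval ceiling, step 1**: dropping the window indicator, `T_ε(ψ) ≤ Σ_m S_ψ(m) = Σ_x ‖P_x ψ‖²`
for EVERY Fock vector (no ground-state input). [cite: KLS1988PRL, p. 2582] -/
theorem windowSum_le_localPairSum (ε : ℝ) (ψ : Fock (Orb (FermionTorus 2 L))) :
    (∑ m : TorusSite 2 L, if m ≠ 0 ∧ momentumNormSq L m ≤ ε ^ 2 then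
        pairStructureFactor dWaveFormFactor L ψ m else 0) ≤
      ∑ x : TorusSite 2 L, (star (localPair dWaveFormFactor L x *ᵥ ψ) ⬝ᵥ
        (localPair dWaveFormFactor L x *ᵥ ψ)).re := by
  rw [← sum_pairStructureFactor]
  refine Finset.sum_le_sum fun m _ => ?_
  split_ifs
  · exact le_rfl
  · exact pairStructureFactor_nonneg _ _ _ _

/-- `Σ_{e ∈ {0, ±e₁, ±e₂}} |d(e)/√2| = 4/√2` for the `d_{x²-y²}` form factor. [folklore] -/
theorem sum_abs_dWaveFormFactor_div_sqrt_two :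
    ∑ e ∈ insert (0 : Site 2) unitSteps, |dWaveFormFactor e / Real.sqrt 2| = 4 * (1 / Real.sqrt 2) := by
  have h1 : dWaveFormFactor (Pi.single 0 1) = 1 := if_pos (Or.inl rfl)
  have h2 : dWaveFormFactor (-Pi.single 0 1) = 1 := if_pos (Or.inr rfl)
  have hne1 : ¬ ((Pi.single 1 1 : Site 2) = Pi.single 0 1 ∨ (Pi.single 1 1 : Site 2) = -Pi.single 0 1) := by
    decide
  have hne2 : ¬ ((-Pi.single 1 1 : Site 2) = Pi.single 0 1 ∨ (-Pi.single 1 1 : Site 2) = -Pi.single 0 1) := by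
    decide
  have h3 : dWaveFormFactor (Pi.single 1 1) = -1 := by
    unfold dWaveFormFactor; rw [if_neg hne1, if_pos (Or.inl rfl)]
  have h4 : dWaveFormFactor (-Pi.single 1 1) = -1 := by
    unfold dWaveFormFactor; rw [if_neg hne2, if_pos (Or.inr rfl)]
  have hs2 : (0 : ℝ) < Real.sqrt 2 := Real.sqrt_pos.2 two_pos
  have ha : |(1 : ℝ) / Real.sqrt 2| = 1 / Real.sqrt 2 := abs_of_pos (div_pos one_pos hs2)
  have hb : |(-1 : ℝ) / Real.sqrt 2| = 1 / Real.sqrt 2 := by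
    rw [neg_div, abs_neg, ha]
  simp only [unitSteps]
  rw [Finset.sum_insert (by decide), Finset.sum_insert (by decide), Finset.sum_insert (by decide),
    Finset.sum_insert (by decide), Finset.sum_singleton, dWaveFormFactor_zero, h1, h2, h3, h4, zero_div,
    abs_zero, ha, hb]
  ring

/-- **Operator norm of the local `d`-wave pair**: `‖P_x‖ ≤ 8/√2 = 4√2` (`‖c‖ ≤ 1`, four bonds, two
spin orderings, weight `1/√2`). [cite: Scalapino1995, §2] -/
theorem norm_localPair_dWave_le (x : TorusSite 2 L) :
    ‖localPair dWaveFormFactor L x‖ ≤ 8 * (1 / Real.sqrt 2) := by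
  have h := norm_localPair_le dWaveFormFactor L x
  rw [sum_abs_dWaveFormFactor_div_sqrt_two] at h
  linarith

/-- `(8/√2)² = 32`. [folklore] -/
theorem eight_div_sqrt_two_sq : (8 * (1 / Real.sqrt 2) : ℝ) ^ 2 = 32 := by
  rw [mul_pow, div_pow, one_pow, Real.sq_sqrt two_pos.le]
  norm_num

/-- **Local pair weight bound**: `‖P_x ψ‖² ≤ 32 ‖ψ‖²` for every Fock vector. [cite: Scalapino1995, §2] -/
theorem localPair_dWave_mulVec_normSq_le (x : TorusSite 2 L) (ψ : Fock (Orb (FermionTorus 2 L))) :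
    (star (localPair dWaveFormFactor L x *ᵥ ψ) ⬝ᵥ (localPair dWaveFormFactor L x *ᵥ ψ)).re ≤
      32 * (star ψ ⬝ᵥ ψ).re := by
  rw [← eucNorm_sq, ← eucNorm_sq, ← eight_div_sqrt_two_sq, ← mul_pow]
  have h0 : 0 ≤ eucNorm (localPair dWaveFormFactor L x *ᵥ ψ) := eucNorm_nonneg _
  have h1 : eucNorm (localPair dWaveFormFactor L x *ᵥ ψ) ≤ 8 * (1 / Real.sqrt 2) * eucNorm ψ :=
    (eucNorm_mulVec_le _ _).trans
      (mul_le_mul_of_nonneg_right (norm_localPair_dWave_le L x) (eucNorm_nonneg _))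
  exact pow_le_pow_left₀ h0 h1 2

/-- **Parseval ceiling**: for every NORMALISED Fock vector and every `ε`,
`T_ε(ψ) ≤ Σ_x ‖P_x ψ‖² ≤ 32 L²` — no Hamiltonian, no ground state. The crux asserts the improvement
factor `Cε/32` over this for sector ground states; it is therefore AUTOMATIC at `ε ≥ 32/C` and has content
only as `ε → 0`. [cite: KLS1988PRL, p. 2582] -/
theorem windowSum_le_thirtyTwo_mul_sq (ε : ℝ) {ψ : Fock (Orb (FermionTorus 2 L))}
    (hψ : star ψ ⬝ᵥ ψ = 1) :
    (∑ m : TorusSite 2 L, if m ≠ 0 ∧ momentumNormSq L m ≤ ε ^ 2 then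
        pairStructureFactor dWaveFormFactor L ψ m else 0) ≤ 32 * (L : ℝ) ^ 2 := by
  refine (windowSum_le_localPairSum L ε ψ).trans ?_
  calc ∑ x : TorusSite 2 L, (star (localPair dWaveFormFactor L x *ᵥ ψ) ⬝ᵥ
          (localPair dWaveFormFactor L x *ᵥ ψ)).re
      ≤ ∑ _x : TorusSite 2 L, (32 : ℝ) := Finset.sum_le_sum fun x _ => by
          simpa [hψ] using localPair_dWave_mulVec_normSq_le L x ψ
    _ = 32 * (L : ℝ) ^ 2 := by
          have hcard : Fintype.card (TorusSite 2 L) = L ^ 2 := by simp [TorusSite, ZMod.card]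
          rw [Finset.sum_const, Finset.card_univ, hcard, nsmul_eq_mul]
          push_cast; ring

/-- **The bound of the crux is automatic once `32 ≤ C ε`** (every normalised vector, no ground-state
hypothesis): the content of `WindowInfraredBound` is the regime `ε → 0`. [folklore] -/
theorem windowSum_le_of_thirtyTwo_le {C ε : ℝ} (hCε : 32 ≤ C * ε) {ψ : Fock (Orb (FermionTorus 2 L))}
    (hψ : star ψ ⬝ᵥ ψ = 1) :
    (∑ m : TorusSite 2 L, if m ≠ 0 ∧ momentumNormSq L m ≤ ε ^ 2 then
        pairStructureFactor dWaveFormFactor L ψ m else 0) ≤ C * ε * (L : ℝ) ^ 2 :=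
  (windowSum_le_thirtyTwo_mul_sq L ε hψ).trans (mul_le_mul_of_nonneg_right hCε (sq_nonneg _))

omit [NeZero L] in
/-- A nonzero momentum label has `Σᵢ (valMinAbs mᵢ)² ≥ 1`. [folklore] -/
theorem one_le_sum_valMinAbs_sq {m : TorusSite 2 L} (hm : m ≠ 0) :
    (1 : ℝ) ≤ ∑ i, (((m i).valMinAbs : ℤ) : ℝ) ^ 2 := by
  obtain ⟨i, hi⟩ : ∃ i, m i ≠ 0 := by
    by_contra h
    push Not at h
    exact hm (funext h)
  have hv : (m i).valMinAbs ≠ 0 := fun h => hi ((ZMod.valMinAbs_eq_zero (m i)).1 h)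
  have h1 : (1 : ℝ) ≤ (((m i).valMinAbs : ℤ) : ℝ) ^ 2 := by
    have : (1 : ℤ) ≤ (m i).valMinAbs ^ 2 := by
      have := Int.one_le_abs hv
      nlinarith [abs_nonneg ((m i).valMinAbs), sq_abs ((m i).valMinAbs)]
    exact_mod_cast this
  exact h1.trans (Finset.single_le_sum (f := fun i => (((m i).valMinAbs : ℤ) : ℝ) ^ 2)
    (fun j _ => sq_nonneg _) (Finset.mem_univ i))

/-- **Empty window**: if `ε² < (2π/L)²` no nonzero label lies in the window and `T_ε(ψ) = 0`; the crux
binds only pairs `(ε, L)` with `ε L ≥ 2π`, where its right-hand side is `≥ 2π C L`. [folklore] -/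
theorem windowSum_eq_zero_of_sq_lt {ε : ℝ} (hε : ε ^ 2 < (2 * Real.pi / (L : ℝ)) ^ 2)
    (ψ : Fock (Orb (FermionTorus 2 L))) :
    (∑ m : TorusSite 2 L, if m ≠ 0 ∧ momentumNormSq L m ≤ ε ^ 2 then
        pairStructureFactor dWaveFormFactor L ψ m else 0) = 0 := by
  refine Finset.sum_eq_zero fun m _ => ?_
  rw [if_neg]
  rintro ⟨hm, hle⟩
  have h1 := one_le_sum_valMinAbs_sq L hm
  have hpos : 0 ≤ (2 * Real.pi / (L : ℝ)) ^ 2 := sq_nonneg _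
  have : (2 * Real.pi / (L : ℝ)) ^ 2 ≤ momentumNormSq L m := by
    rw [momentumNormSq_apply]
    nlinarith
  linarith

/-- **`ε₀` is cosmetic.** From the crux one gets the same bound for ALL `ε > 0` (constant
`max C (32/ε₀)`), by the Parseval ceiling above `ε₀`. So a prover may fix any convenient `ε₀`, and a
refuter gains nothing from large `ε`. [folklore] -/
theorem windowInfraredBound_allEps (h : WindowInfraredBound) :
    ∀ U : ℝ, 0 < U → ∀ δ ∈ Set.Ioo (0:ℝ) (1 / 2), ∃ C : ℝ, 0 ≤ C ∧ ∃ L₀ : ℕ,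
      ∀ ε : ℝ, 0 < ε → ∀ (L : ℕ) [NeZero L], L₀ ≤ L → Even L →
        ∀ ψ : Fock (Orb (FermionTorus 2 L)), star ψ ⬝ᵥ ψ = 1 →
          IsGroundStateInSector (hubbardTorus 2 L 1 U) (2 * ⌊(1 - δ) * (L : ℝ) ^ 2 / 2⌋₊) 0 ψ →
            (∑ m : TorusSite 2 L, if m ≠ 0 ∧ momentumNormSq L m ≤ ε ^ 2 then
                pairStructureFactor dWaveFormFactor L ψ m else 0) ≤ C * ε * (L : ℝ) ^ 2 := by
  intro U hU δ hδ
  obtain ⟨C, ε₀, hC, hε₀, L₀, hmain⟩ := (crux_iff_structureFactor.1 h) U hU δ hδ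
  refine ⟨max C (32 / ε₀), le_max_of_le_left hC, L₀, fun ε hε L _ hL hev ψ hψ hgs => ?_⟩
  rcases le_or_gt ε ε₀ with hle | hlt
  · exact (hmain ε ⟨hε, hle⟩ L hL hev ψ hψ hgs).trans
      (mul_le_mul_of_nonneg_right (mul_le_mul_of_nonneg_right (le_max_left _ _) hε.le) (sq_nonneg _))
  · refine windowSum_le_of_thirtyTwo_le L ?_ hψ
    calc (32 : ℝ) = 32 / ε₀ * ε₀ := by field_simp
      _ ≤ 32 / ε₀ * ε := mul_le_mul_of_nonneg_left hlt.le (by positivity)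
      _ ≤ max C (32 / ε₀) * ε := mul_le_mul_of_nonneg_right (le_max_right _ _) hε.le

/-! ## §2 Load-bearing hypotheses: the zero mode and the normalisation -/

/-! ### The zero mode: `m ≠ 0` is load-bearing -/

/-- The zero mode alone is below the window sum WITH the zero mode included (all terms are
nonnegative and `|q_0|² = 0 ≤ ε²`). [folklore] -/
theorem pairStructureFactor_zero_le_windowSumWithZero (ε : ℝ) (ψ : Fock (Orb (FermionTorus 2 L))) :
    pairStructureFactor dWaveFormFactor L ψ 0 ≤
      ∑ m : TorusSite 2 L, if momentumNormSq L m ≤ ε ^ 2 then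
        pairStructureFactor dWaveFormFactor L ψ m else 0 := by
  have h0 : (if momentumNormSq L (0 : TorusSite 2 L) ≤ ε ^ 2 then
      pairStructureFactor dWaveFormFactor L ψ 0 else 0) = pairStructureFactor dWaveFormFactor L ψ 0 := by
    rw [if_pos]; rw [momentumNormSq_zero]; exact sq_nonneg _
  rw [← h0]
  exact Finset.single_le_sum (f := fun m => if momentumNormSq L m ≤ ε ^ 2 then
      pairStructureFactor dWaveFormFactor L ψ m else 0)
    (fun m _ => by split_ifs <;> [exact pairStructureFactor_nonneg _ _ _ _; exact le_rfl])
    (Finset.mem_univ _)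

/-- A nonnegative real which is `≤ C ε` for every `ε ∈ (0, ε₀]` vanishes. [folklore] -/
theorem eq_zero_of_le_mul_forall {x C ε₀ : ℝ} (hx : 0 ≤ x) (hC : 0 ≤ C) (hε₀ : 0 < ε₀)
    (h : ∀ ε ∈ Set.Ioc (0:ℝ) ε₀, x ≤ C * ε) : x = 0 := by
  by_contra hne
  have hxpos : 0 < x := lt_of_le_of_ne hx (Ne.symm hne)
  set ε := min ε₀ (x / (2 * (C + 1))) with hεdef
  have hεpos : 0 < ε := lt_min hε₀ (by positivity)
  have hle := h ε ⟨hεpos, min_le_left _ _⟩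
  have h2 : C * ε ≤ C * (x / (2 * (C + 1))) := mul_le_mul_of_nonneg_left (min_le_right _ _) hC
  have h3 : C * (x / (2 * (C + 1))) < x := by
    rw [mul_div_assoc']
    rw [div_lt_iff₀ (by positivity)]
    nlinarith
  linarith

/-- **`m ≠ 0` is load-bearing (strongest form).** If the window sum is taken WITH the zero mode, the
statement forces `Δ_d ψ = 0` — exact vanishing of the `d`-wave pair field on EVERY normalised sector
ground state of EVERY large even torus at EVERY `(U, δ)`: at fixed `L` the window `|q_m| ≤ ε` always
contains `m = 0`, so `S_ψ(0) ≤ C ε L²` for all small `ε`, i.e. `‖Δ_d ψ‖² = 0`. (So that variant denies not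
only long-range order but any pair amplitude; the crux proper is insensitive to the `k = 0` condensate by
design.) [folklore] -/
theorem pairField_mulVec_eq_zero_of_withZeroMode
    (h : ∀ U : ℝ, 0 < U → ∀ δ ∈ Set.Ioo (0:ℝ) (1 / 2), ∃ C ε₀ : ℝ, 0 ≤ C ∧ 0 < ε₀ ∧ ∃ L₀ : ℕ,
      ∀ ε ∈ Set.Ioc (0:ℝ) ε₀, ∀ (L : ℕ) [NeZero L], L₀ ≤ L → Even L →
        ∀ ψ : Fock (Orb (FermionTorus 2 L)), star ψ ⬝ᵥ ψ = 1 →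
          IsGroundStateInSector (hubbardTorus 2 L 1 U) (2 * ⌊(1 - δ) * (L : ℝ) ^ 2 / 2⌋₊) 0 ψ →
            (∑ m : TorusSite 2 L, if momentumNormSq L m ≤ ε ^ 2 then
                pairStructureFactor dWaveFormFactor L ψ m else 0) ≤ C * ε * (L : ℝ) ^ 2) :
    ∀ U : ℝ, 0 < U → ∀ δ ∈ Set.Ioo (0:ℝ) (1 / 2), ∃ L₀ : ℕ, ∀ (L : ℕ) [NeZero L], L₀ ≤ L → Even L →
      ∀ ψ : Fock (Orb (FermionTorus 2 L)), star ψ ⬝ᵥ ψ = 1 →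
        IsGroundStateInSector (hubbardTorus 2 L 1 U) (2 * ⌊(1 - δ) * (L : ℝ) ^ 2 / 2⌋₊) 0 ψ →
          pairField dWaveFormFactor L *ᵥ ψ = 0 := by
  intro U hU δ hδ
  obtain ⟨C, ε₀, hC, hε₀, L₀, hmain⟩ := h U hU δ hδ
  refine ⟨L₀, fun L _ hL hev ψ hψ hgs => ?_⟩
  have hL2 : (0 : ℝ) < (L : ℝ) ^ 2 := by
    have := NeZero.pos L
    positivity
  -- `S_ψ(0) ≤ C ε L²` for every `ε ∈ (0, ε₀]`
  have hS : ∀ ε ∈ Set.Ioc (0:ℝ) ε₀,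
      pairStructureFactor dWaveFormFactor L ψ 0 ≤ C * (L : ℝ) ^ 2 * ε := fun ε hε =>
    ((pairStructureFactor_zero_le_windowSumWithZero L ε ψ).trans (hmain ε hε L hL hev ψ hψ hgs)).trans_eq
      (by ring)
  have h0 : pairStructureFactor dWaveFormFactor L ψ 0 = 0 :=
    eq_zero_of_le_mul_forall (pairStructureFactor_nonneg _ _ _ _) (by positivity) hε₀ hS
  -- `‖Δ_d ψ‖² / L² = 0`, hence `Δ_d ψ = 0`
  rw [pairStructureFactor_apply, pairFieldAt_zero, div_eq_zero_iff, or_iff_left hL2.ne'] at h0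
  have hre : star (pairField dWaveFormFactor L *ᵥ ψ) ⬝ᵥ (pairField dWaveFormFactor L *ᵥ ψ) = 0 := by
    have hnn := dotProduct_star_self_nonneg (pairField dWaveFormFactor L *ᵥ ψ)
    obtain ⟨hre0, him0⟩ := Complex.nonneg_iff.1 hnn
    exact Complex.ext (by simpa using h0) (by simpa using him0.symm)
  exact dotProduct_star_self_eq_zero.1 hre

/-! ### Normalisation: `star ψ ⬝ᵥ ψ = 1` is load-bearing -/

omit [NeZero L] in
/-- Ground states form a cone: `IsGroundStateInSector` is invariant under nonzero scalars. [folklore] -/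
theorem isGroundStateInSector_smul {H : Matrix (Finset (Orb (FermionTorus 2 L))) (Finset (Orb (FermionTorus 2 L))) ℂ}
    {N : ℕ} {M : ℝ} {ψ : Fock (Orb (FermionTorus 2 L))} (hψ : IsGroundStateInSector H N M ψ)
    {c : ℂ} (hc : c ≠ 0) : IsGroundStateInSector H N M (c • ψ) := by
  obtain ⟨hmem, hne, heig⟩ := hψ
  refine ⟨Submodule.smul_mem _ c hmem, smul_ne_zero hc hne, ?_⟩
  rw [Matrix.mulVec_smul, heig, smul_comm]

/-- The structure factor is quadratic: `S_{cψ}(m) = ‖c‖² S_ψ(m)`. [folklore] -/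
theorem pairStructureFactor_smul (g : Site 2 → ℝ) (c : ℂ) (ψ : Fock (Orb (FermionTorus 2 L)))
    (m : TorusSite 2 L) :
    pairStructureFactor g L (c • ψ) m = ‖c‖ ^ 2 * pairStructureFactor g L ψ m := by
  rw [pairStructureFactor_apply, pairStructureFactor_apply, Matrix.mulVec_smul, star_smul,
    smul_dotProduct, dotProduct_smul, smul_smul, smul_eq_mul, Complex.star_def,
    Complex.re_mul_ofReal_of_conj_mul_self c, mul_div_assoc]
  where
  /-- `Re ((conj c * c) * z) = ‖c‖² * Re z` -/
  Complex.re_mul_ofReal_of_conj_mul_self (c : ℂ) {z : ℂ} :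
      ((starRingEnd ℂ) c * c * z).re = ‖c‖ ^ 2 * z.re := by
    rw [Complex.conj_mul', ← Complex.ofReal_pow, Complex.re_ofReal_mul]

/-- **Normalisation is load-bearing.** If the bound is asked of EVERY sector ground state regardless of
its norm, scaling `ψ ↦ cψ` forces the window tail of every ground state to VANISH identically, i.e.
`Δ_d(m) ψ = 0` for every nonzero window momentum `m` (`|q_m| ≤ ε₀`) on every large even torus at every
`(U, δ)` — again a denial of any small-momentum pair amplitude, far beyond an infrared bound. [folklore] -/
theorem pairFieldAt_mulVec_eq_zero_of_withoutNormalisation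
    (h : ∀ U : ℝ, 0 < U → ∀ δ ∈ Set.Ioo (0:ℝ) (1 / 2), ∃ C ε₀ : ℝ, 0 ≤ C ∧ 0 < ε₀ ∧ ∃ L₀ : ℕ,
      ∀ ε ∈ Set.Ioc (0:ℝ) ε₀, ∀ (L : ℕ) [NeZero L], L₀ ≤ L → Even L →
        ∀ ψ : Fock (Orb (FermionTorus 2 L)),
          IsGroundStateInSector (hubbardTorus 2 L 1 U) (2 * ⌊(1 - δ) * (L : ℝ) ^ 2 / 2⌋₊) 0 ψ →
            (∑ m : TorusSite 2 L, if m ≠ 0 ∧ momentumNormSq L m ≤ ε ^ 2 then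
                pairStructureFactor dWaveFormFactor L ψ m else 0) ≤ C * ε * (L : ℝ) ^ 2) :
    ∀ U : ℝ, 0 < U → ∀ δ ∈ Set.Ioo (0:ℝ) (1 / 2), ∃ ε₀ : ℝ, 0 < ε₀ ∧ ∃ L₀ : ℕ,
      ∀ (L : ℕ) [NeZero L], L₀ ≤ L → Even L → ∀ ψ : Fock (Orb (FermionTorus 2 L)),
        IsGroundStateInSector (hubbardTorus 2 L 1 U) (2 * ⌊(1 - δ) * (L : ℝ) ^ 2 / 2⌋₊) 0 ψ →
          ∀ m : TorusSite 2 L, m ≠ 0 → momentumNormSq L m ≤ ε₀ ^ 2 →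
            pairFieldAt dWaveFormFactor L m *ᵥ ψ = 0 := by
  intro U hU δ hδ
  obtain ⟨C, ε₀, hC, hε₀, L₀, hmain⟩ := h U hU δ hδ
  refine ⟨ε₀, hε₀, L₀, fun L _ hL hev ψ hgs m hm hwin => ?_⟩
  have hL2 : (0 : ℝ) < (L : ℝ) ^ 2 := by
    have := NeZero.pos L
    positivity
  -- the window tail `T(ψ) := Σ_{m ≠ 0, window} S_ψ(m)` at `ε = ε₀`
  set T : Fock (Orb (FermionTorus 2 L)) → ℝ := fun φ =>
    ∑ m : TorusSite 2 L, if m ≠ 0 ∧ momentumNormSq L m ≤ ε₀ ^ 2 then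
      pairStructureFactor dWaveFormFactor L φ m else 0 with hTdef
  have hTnn : ∀ φ, 0 ≤ T φ := fun φ =>
    Finset.sum_nonneg fun m _ => by split_ifs <;> [exact pairStructureFactor_nonneg _ _ _ _; exact le_rfl]
  have hTsmul : ∀ (c : ℂ) φ, T (c • φ) = ‖c‖ ^ 2 * T φ := fun c φ => by
    simp only [hTdef, Finset.mul_sum]
    refine Finset.sum_congr rfl fun m _ => ?_
    split_ifs
    · exact pairStructureFactor_smul L dWaveFormFactor c φ m
    · exact (mul_zero _).symm
  -- scaling: `n² T(ψ) = T(n ψ) ≤ C ε₀ L²` for every natural `n ≥ 1`, hence `T ψ = 0`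
  have hbound : ∀ n : ℕ, ((n + 1 : ℕ) : ℝ) ^ 2 * T ψ ≤ C * ε₀ * (L : ℝ) ^ 2 := fun n => by
    have hc : ((n + 1 : ℕ) : ℂ) ≠ 0 := by exact_mod_cast Nat.succ_ne_zero n
    have := hmain ε₀ ⟨hε₀, le_rfl⟩ L hL hev (((n + 1 : ℕ) : ℂ) • ψ) (isGroundStateInSector_smul L hgs hc)
    rw [show (∑ m : TorusSite 2 L, if m ≠ 0 ∧ momentumNormSq L m ≤ ε₀ ^ 2 then
        pairStructureFactor dWaveFormFactor L (((n + 1 : ℕ) : ℂ) • ψ) m else 0) =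
        T (((n + 1 : ℕ) : ℂ) • ψ) from rfl, hTsmul, Complex.norm_natCast] at this
    exact this
  have hT0 : T ψ = 0 := by
    by_contra hne
    have hpos : 0 < T ψ := lt_of_le_of_ne (hTnn ψ) (Ne.symm hne)
    obtain ⟨n, hn⟩ := exists_nat_gt (C * ε₀ * (L : ℝ) ^ 2 / T ψ)
    have h1 := hbound n
    have h2 : C * ε₀ * (L : ℝ) ^ 2 < ((n + 1 : ℕ) : ℝ) ^ 2 * T ψ := by
      rw [div_lt_iff₀ hpos] at hn
      have hn1 : (n : ℝ) ≤ ((n + 1 : ℕ) : ℝ) ^ 2 := by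
        push_cast
        nlinarith
      nlinarith
    linarith
  -- a vanishing sum of nonnegative terms: the term at `m` vanishes
  have hterm : (if m ≠ 0 ∧ momentumNormSq L m ≤ ε₀ ^ 2 then
      pairStructureFactor dWaveFormFactor L ψ m else 0) = 0 := by
    have := (Finset.sum_eq_zero_iff_of_nonneg (s := Finset.univ) (fun m' _ => by
      split_ifs <;> [exact pairStructureFactor_nonneg dWaveFormFactor L ψ m'; exact le_rfl])).1 hT0 m
      (Finset.mem_univ m)
    exact this
  rw [if_pos ⟨hm, hwin⟩, pairStructureFactor_apply, div_eq_zero_iff, or_iff_left hL2.ne'] at hterm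
  have hre : star (pairFieldAt dWaveFormFactor L m *ᵥ ψ) ⬝ᵥ (pairFieldAt dWaveFormFactor L m *ᵥ ψ) = 0 := by
    have hnn := dotProduct_star_self_nonneg (pairFieldAt dWaveFormFactor L m *ᵥ ψ)
    obtain ⟨hre0, him0⟩ := Complex.nonneg_iff.1 hnn
    exact Complex.ext (by simpa using hterm) (by simpa using him0.symm)
  exact dotProduct_star_self_eq_zero.1 hre

/-! ## §3 Saturated ferromagnets: `T_ε ≡ 0` -/

variable (g : Site 2 → ℝ)

/-- **Every pair Fourier mode annihilates a saturated ferromagnet**: `Δ_g(m) ψ = 0` for an `N`-particle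
`ψ` with `S² ψ = (N/2)(N/2+1) ψ` (the `SU(2)` selection rule of route NoGo, crux 5, mode by mode).
Tasaki, Prog. Theor. Phys. 99 (1998) 489, p. 20. [folklore] -/
theorem pairFieldAt_mulVec_eq_zero_of_saturated (m : TorusSite 2 L) {N : ℕ}
    {ψ : Fock (Orb (FermionTorus 2 L))} (hN : IsNParticle N ψ)
    (hS : spinSq *ᵥ ψ = (((N : ℝ) / 2 * ((N : ℝ) / 2 + 1) : ℝ) : ℂ) • ψ) :
    pairFieldAt g L m *ᵥ ψ = 0 := by
  rw [pairFieldAt_def, Matrix.sum_mulVec]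
  refine Finset.sum_eq_zero fun x _ => ?_
  rw [Matrix.smul_mulVec,
    Summit.HubbardSuperconductivity.NoGo.localPair_mulVec_eq_zero_of_saturated g L x hN hS, smul_zero]

/-- Hence the pair structure factor of a saturated ferromagnet vanishes at EVERY momentum. [folklore] -/
theorem pairStructureFactor_eq_zero_of_saturated (m : TorusSite 2 L) {N : ℕ}
    {ψ : Fock (Orb (FermionTorus 2 L))} (hN : IsNParticle N ψ)
    (hS : spinSq *ᵥ ψ = (((N : ℝ) / 2 * ((N : ℝ) / 2 + 1) : ℝ) : ℂ) • ψ) :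
    pairStructureFactor g L ψ m = 0 := by
  rw [pairStructureFactor_apply, pairFieldAt_mulVec_eq_zero_of_saturated L g m hN hS]
  simp

/-- **No counterexample to `WindowInfraredBound` lives in a saturated-ferromagnetic (Nagaoka) phase**:
along any `N`-particle state of maximal total spin — in particular the `S^z = 0` member of a saturated
sector ground-state multiplet — the window tail of the crux is `0 ≤ C ε L²` for every `C ≥ 0`.  So the
large-`U`, small-`δ` corner is harmless for the crux exactly where route NoGo hopes for ferromagnetism;
a refutation needs a PAIRED inhomogeneous state (phase separation with a superconducting component, or a
pair-density wave with `|Q| → 0`). Tasaki, Prog. Theor. Phys. 99 (1998) 489, p. 20–21. [folklore] -/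
theorem windowSum_eq_zero_of_saturated (ε : ℝ) {N : ℕ} {ψ : Fock (Orb (FermionTorus 2 L))}
    (hN : IsNParticle N ψ) (hS : spinSq *ᵥ ψ = (((N : ℝ) / 2 * ((N : ℝ) / 2 + 1) : ℝ) : ℂ) • ψ) :
    (∑ m : TorusSite 2 L, if m ≠ 0 ∧ momentumNormSq L m ≤ ε ^ 2 then
        pairStructureFactor dWaveFormFactor L ψ m else 0) = 0 :=
  Finset.sum_eq_zero fun m _ => by
    rw [pairStructureFactor_eq_zero_of_saturated L dWaveFormFactor m hN hS, ite_self]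

/-! ## §4 Attacks run on paper / by computation (cycle 1) -/

/-- **Attack log, cycle 1** (prose record; the `True` carrier keeps it in the elaborated file).

1. *Triviality via Parseval* — fails: §1 gives only `T_ε ≤ 32 L²`, the crux needs the factor `Cε/32`.
   The quadratic form `ψ ↦ T_ε(ψ)` on the sector HAS eigenvalues `~ L²` (pair condensates at small
   momenta), so no operator inequality closes the crux without the ground-state property.
2. *Vacuity* — fails: `szSector (2⌊(1-δ)L²/2⌋) 0 ≠ ⊥` (`⌊(1-δ)L²/2⌋ ≤ L²`), ground states exist.
3. *`U → 0⁺` (planner's "cheapest falsifier")* — kit job `j015079` (Wick's theorem in the Slater sector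
   ground state filling the lowest `N/2` levels per spin — ONE ground state of the possibly open shell),
   `δ ∈ {0.1, 0.2, 0.3, 0.45}`, `L ∈ {16, …, 256}`: the `d`-wave pair structure factor of the Fermi sea is
   BOUNDED (`S_ψ(0) = max_m S_ψ(m) ≈ 2.98, 2.18, 1.53, 0.80`; `Σ_x ‖P_xψ‖²/L² ≈ 0.67, 0.44, 0.27, 0.11`, far
   below the ceiling `32`), and the window tail follows the FLAT law `T_ε ≈ κ ε² L²`, `κ ≈ 0.21, 0.15, 0.10,
   0.055` (`ε ≤ 0.4`), with `sup_ε T_ε/(εL²) ≈ 0.20` attained near `ε ≈ 3`.  So at `U = 0` the bound holds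
   with `C = 1/4` and any `ε₀` along these ground states; the hypothesis `0 < U` is not where the content is.
   (Sup over the degenerate open-shell ground space not computed; shell multiplicities are `O(8)` generically,
   pair weight from shell orbitals is `O(1)`.)
4. *Large `U`, small `δ` (Nagaoka corner)* — §3: saturated ferromagnets have `T_ε = 0`.  No kill, ever.
5. *Degenerate ground multiplets* — superposing ground states of different total momenta cannot amplify
   `T_ε`: `Δ_d(m)` maps the momentum-`K` sector to momentum `K - q_m`, so `‖Δ_d(m) Σ_K ψ_K‖² = Σ_K ‖Δ_d(m)ψ_K‖²`
   (on paper; fermionic translations: `fockTranslate` in `FockRelabel.lean`).  `SU(2)`, `D₄`, pseudospin give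
   `O(1)` multiplicities inside the `(N, S^z = 0)` sector.
6. *Physics kill candidates (none rigorous).*  (a) PHASE SEPARATION with a paired hole-rich component:
   then `⟨P_x† P_y⟩` is modulated by the density profile and `S_ψ(q_min) ~ a² L²`, `T_ε ≥ c L² ≫ CεL²` for
   `ε < c/C` — claimed by mVMC at `U/t = 10`, `δ ≲ 0.2` (Misawa–Imada, PRB 90 (2014) 115137) and
   Ido–Ohgoe–Imada, PRB 97 (2018) 045138 (charge-inhomogeneous states competing with uniform d-wave SC),
   by fixed-node GFMC at large `U` (Cosentini–Capone–Guidoni–Bachelet, PRB 58 (1998) R14685), contested by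
   other VMC/AFQMC (Tocchio–Becca–Sorella, PRB 94 (2016) 195126; Sorella 2023).  (b) PAIR-DENSITY WAVE with
   `|Q| → 0`: not reported for the pure `t' = 0` model (its stripes are charge/spin density waves with
   SUPPRESSED pairing, QinEtAl2020; PDW tendencies appear in `t-J`/`t' ≠ 0` variants) — a PDW at FIXED `Q ≠ 0`
   is harmless (`ε₀ < |Q|`).  (c) a `q ~ 1/L` mesoscopic condensate in some sector ground state: no mechanism
   known.  Literature search degraded (local FTS down, OpenAlex/S2 429; arXiv/Crossref used).
7. *Barrier catalogue* (`Literature/Barriers/HubbardSuperconductivity/`): no entry yields a NEGATIVE for an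
   infrared UPPER bound; `PureModelStripeCompetition` concerns absence of `k = 0` order at `(8, 1/8)` (which
   makes the crux EASIER there, `S_ψ` bounded), `LROForcesLowLyingStates` concerns low-lying states, not
   structure factors.  `ledger negatives`: only `KlsOrderOpenness_refuted` (unrelated mechanism).
8. *Why it resists (and why it is unprovable by the same token).*  The statement is a `T = 0` infrared upper
   bound WITHOUT reflection positivity; its negation is macroscopic small-momentum pair condensation in an
   exact Hubbard ground state.  Both directions need control of `IsGroundStateInSector (hubbardTorus 2 L 1 U)`
   at finite doping for all large `L`, which does not exist at any coupling (no convergent expansion in `U`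
   uniformly in `L`; no solvable point inside `(0,∞) × (0,1/2)`).  Recommendation recorded by two route
   reviewers stands: both routes consume the crux at ONE `(U, δ)`; the `∀ (U, δ)` form only enlarges the
   physical attack surface (phase separation anywhere kills it) without helping any prover. [folklore] -/
theorem attacksOnPaper : True := trivial

/-! ## §5 Near-miss (ON PAPER only — the single `sorry` of this work file; NOT a claim of the tree) -/

/-- The crux with the GROUND-STATE hypothesis replaced by mere sector membership (every normalised
`(N_L, S^z = 0)` vector). [folklore] -/
def WindowBoundAllSectorStates : Prop :=
  ∀ U : ℝ, 0 < U → ∀ δ ∈ Set.Ioo (0:ℝ) (1 / 2), ∃ C ε₀ : ℝ, 0 ≤ C ∧ 0 < ε₀ ∧ ∃ L₀ : ℕ,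
    ∀ ε ∈ Set.Ioc (0:ℝ) ε₀, ∀ (L : ℕ) [NeZero L], L₀ ≤ L → Even L →
      ∀ ψ : Fock (Orb (FermionTorus 2 L)), star ψ ⬝ᵥ ψ = 1 →
        ψ ∈ szSector (Λ := FermionTorus 2 L) (2 * ⌊(1 - δ) * (L : ℝ) ^ 2 / 2⌋₊) 0 →
          (∑ m : TorusSite 2 L, if m ≠ 0 ∧ momentumNormSq L m ≤ ε ^ 2 then
              pairStructureFactor dWaveFormFactor L ψ m else 0) ≤ C * ε * (L : ℝ) ^ 2

/-- **NEAR-MISS: the ground-state hypothesis is load-bearing** — `WindowBoundAllSectorStates` is FALSE.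
Witness (on paper; any `U, δ`; given `C, ε₀, L₀`): an even `L ≡ 0 (mod 6)`, `L ≥ max L₀ (2π/ε₀)`, large;
`ε := 2π/L`, so the window is `{±e₁, ±e₂}` and the right-hand side is `2π C L`.  SLOT CONDENSATE: let
`A` = rows `0 … a-1` (fully doubly occupied: `2aL` electrons), `B` = the other rows, and let the SLOTS be the
pairwise site-disjoint horizontal bonds `s_{j,r} = ((3j, r), (3j+1, r))`, `r ∈ B`, `0 ≤ j < L/3` (sites
`(3j+2, r)` are empty buffers), `M = (L-a)L/3` of them; `b_s† = (c†_{y↑}c†_{y+e₁,↓} - c†_{y↓}c†_{y+e₁,↑})/√2`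
(`y` the left site).  Put `ψ_n ∝ Π_{x∈A} c†_{x↑}c†_{x↓} · Σ_{T ⊆ slots, |T| = n} e^{i q₁·Σ_{s∈T} y_s} Π_{s∈T} b_s† |0⟩`,
`q₁ = (2π/L)e₁`, with `a, n` solving `2aL + 2n = N_L = 2⌊(1-δ)L²/2⌋`, `n ∈ [10CL, 10CL + L)` (every residue
mod `L` occurs, so `a ∈ ℕ`; `a ≈ (1-δ)L/2`, `M ≈ (1+δ)L²/6 ≫ n`).  `ψ_n ∈ szSector N_L 0` (singlets and
doublons), and slot creators on disjoint sites COMMUTE (even operators), so the `|T⟩` are orthonormal and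
the slots carry an exact spin-`M/2` (Dicke / hard-core boson) algebra:
`‖Σ_s e^{-iq₁y_s} b_s ψ_n‖² / ‖ψ_n‖² = (M-n+1)² C(M,n-1)/C(M,n) = n(M-n+1)` — NO approximation.
The clean part of `Δ_d(q₁)ψ_n` (configurations "A-doublons + (n-1) complete slots") is exactly
`(1 + e^{-2πi/L}) Σ_s e^{-iq₁ y_s} b_s ψ_n` (both orderings `(y, +e₁)`, `(y+e₁, -e₁)` of a slot bond contribute
`b_s`, `g(±e₁)/√2 · √2 = 1`; the on-site term has `g(0) = 0`), while every other term of `Δ_d(q₁)` (vertical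
bonds, buffer bonds, bonds inside `A` or straddling `A`/`B`) produces broken doublons or half-emptied slots,
i.e. vectors supported on occupation patterns ORTHOGONAL to the clean ones.  Hence
`S_{ψ_n}(q₁) ≥ (2 + 2cos(2π/L)) · n (M-n+1) / L² ≥ 3 n (1+δ)/6 · (1 - o(1)) ≥ 5 C L (1+δ)(1-o(1)) > 2π C L`
for large `L`: `T_ε(ψ_n) ≥ S_{ψ_n}(q₁) > C ε L²`.  The bound is violated by `Θ(L)` pairs condensed at the
smallest momentum, at kinetic energy far above the ground state — a proof of the crux must use the
GROUND-STATE property through the energy, not through sector bookkeeping.  Obstruction to closing it here: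
occupation-basis product states (doublon block × slot Dicke state), their norms and the clean/junk
decomposition of `Δ_d(m)` on them are not in the tree (Jordan–Wigner matrices on `Finset (Orb Λ) → ℂ`);
mechanical but long (est. 1–2 k lines) — the natural cycle-2 target if a disprover cycle is granted. [folklore] -/
theorem not_windowBoundAllSectorStates : ¬ WindowBoundAllSectorStates := by
  sorry

end Summit.HubbardSuperconductivity.HubbardSuperconductivity.Cruxes.WindowInfraredBound.Disproof

end
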